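import Mathlib.Analysis.CStarAlgebra.ContinuousFunctionalCalculus.Basic
import Mathlib.Analysis.CStarAlgebra.ContinuousLinearMap
import Mathlib.Analysis.InnerProductSpace.Adjoint
import Mathlib.Topology.ContinuousMap.Weierstrass
import HarnessLib

/-!
# Real-linear intertwiners pass through the real continuous functional calculus

Let `H` be a complex Hilbert space and `X, Y : H →L[ℂ] H` self-adjoint bounded operators. If a
bounded **real**-linear map `V : H →L[ℝ] H` (for instance a conjugate-linear operator, or an
antiunitary) intertwines `X` and `Y`, i.e. `V (X ψ) = Y (V ψ)` for all `ψ`, then it intertwines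
`g(X)` and `g(Y)` for every continuous `g : ℝ → ℝ`:
`V (g(X) ψ) = g(Y) (V ψ)`.

Mathlib's `Commute.cfc_real` covers the case where `V` is itself an element of the (complex)
C⋆-algebra `H →L[ℂ] H`; the modular theory of Tomita–Takesaki (Rieffel–van Daele's bounded
approach, Pacific J. Math. 69 (1977), Prop. 2.2 (4)–(5) and §3: "from the fact that `JRJ = 2 − R`
it follows easily that `J R^{it} J = (2 − R)^{-it}`") needs it for the real-orthogonal
projections `P`, `Q`, the conjugate-linear `P − Q` and the modular conjugation `J`, none of which
is complex-linear. The proof is the classical one: the identity holds for real polynomials by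
algebra, and polynomials are uniformly dense in `C([-r, r])` (Weierstrass), while the functional
calculus is isometric.

## Main results

* `realCLM_apply_aeval_of_intertwine` — the polynomial case.
* `realCLM_apply_cfc_of_intertwine` — `V (cfc g X ψ) = cfc g Y (V ψ)` for `g` continuous on ℝ.
* `realCLM_apply_cfc_comm` — the case `X = Y`: real-linear maps commuting with `X` commute with
  `cfc g X`.

## References
* M. A. Rieffel, A. van Daele, *A bounded operator approach to Tomita–Takesaki theory*, Pacific
  J. Math. 69 (1977) 187–221, Prop. 2.2 and §3. [RieffelVandaele1977]
-/

noncomputable section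

open Polynomial

-- The real functional calculus on `H →L[ℂ] H` sits at the end of a long instance chain.
set_option synthInstance.maxHeartbeats 200000

namespace Literature.Analysis.OperatorTheory

variable {H : Type*} [NormedAddCommGroup H] [InnerProductSpace ℂ H] [CompleteSpace H]

omit [CompleteSpace H] in
/-- **Polynomial case**: a real-linear intertwiner of `X` and `Y` intertwines `p(X)` and `p(Y)`
for every real polynomial `p`. [folklore] -/
theorem realCLM_apply_aeval_of_intertwine (V : H →L[ℝ] H) {A B : H →L[ℂ] H}
    (hV : ∀ ψ, V (A ψ) = B (V ψ)) (p : ℝ[X]) (ψ : H) :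
    V (aeval A p ψ) = aeval B p (V ψ) := by
  induction p using Polynomial.induction_on generalizing ψ with
  | C r =>
    rw [aeval_C, aeval_C, Algebra.algebraMap_eq_smul_one]
    change V (r • ψ) = r • V ψ
    exact V.map_smul r ψ
  | add p q hp hq =>
    rw [map_add, map_add, add_apply, add_apply, map_add, hp, hq]
  | monomial n r h =>
    rw [pow_succ, ← mul_assoc, map_mul (aeval A), map_mul (aeval B), aeval_X, aeval_X]
    change V (aeval A (C r * X ^ n) (A ψ)) = aeval B (C r * X ^ n) (B (V ψ))
    rw [h, hV]

/-- The real spectrum of a bounded operator lies in `[-‖X‖, ‖X‖]`. [folklore] -/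
theorem spectrum_real_subset_Icc (A : H →L[ℂ] H) :
    spectrum ℝ A ⊆ Set.Icc (-‖A‖) ‖A‖ := by
  intro t ht
  have h1 : ‖t‖ ≤ ‖A‖ * ‖(1 : H →L[ℂ] H)‖ := spectrum.norm_le_norm_mul_of_mem ht
  have h2 : ‖t‖ ≤ ‖A‖ := by
    calc ‖t‖ ≤ ‖A‖ * ‖(1 : H →L[ℂ] H)‖ := h1
      _ ≤ ‖A‖ * 1 := by
        gcongr
        exact ContinuousLinearMap.norm_id_le
      _ = ‖A‖ := mul_one _
  rw [Real.norm_eq_abs] at h2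
  exact ⟨by linarith [neg_abs_le t], le_trans (le_abs_self t) h2⟩

/-- **Uniform polynomial approximation of the functional calculus**: if `|p − g| ≤ ε` on an
interval containing the spectrum then `‖cfc g X − p(X)‖ ≤ ε`. [folklore] -/
theorem norm_cfc_sub_aeval_le {A : H →L[ℂ] H} (hA : IsSelfAdjoint A) {g : ℝ → ℝ}
    (hg : Continuous g) (p : ℝ[X]) {ε : ℝ} (hε : 0 ≤ ε)
    (h : ∀ t ∈ spectrum ℝ A, |p.eval t - g t| ≤ ε) :
    ‖cfc g A - aeval A p‖ ≤ ε := by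
  rw [← cfc_polynomial p A hA, ← cfc_sub g (fun t => p.eval t) A]
  refine norm_cfc_le hε fun t ht => ?_
  rw [Real.norm_eq_abs, abs_sub_comm]
  exact h t ht

/-- **Real-linear intertwiners pass through the real functional calculus**: if
`V (X ψ) = Y (V ψ)` for all `ψ`, with `X`, `Y` self-adjoint and `V` real-linear and bounded, then
`V (g(X) ψ) = g(Y) (V ψ)` for every continuous `g : ℝ → ℝ` (Rieffel–van Daele 1977, used in
Prop. 2.2 (4), (5) and for `J R^{it} J = (2−R)^{−it}` in §3).
[cite: RieffelVandaele1977, Prop. 2.2 and §3 (p. 194)] -/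
theorem realCLM_apply_cfc_of_intertwine (V : H →L[ℝ] H) {A B : H →L[ℂ] H}
    (hA : IsSelfAdjoint A) (hB : IsSelfAdjoint B) (hV : ∀ ψ, V (A ψ) = B (V ψ))
    {g : ℝ → ℝ} (hg : Continuous g) (ψ : H) :
    V (cfc g A ψ) = cfc g B (V ψ) := by
  -- it suffices to prove `‖V (g(X)ψ) − g(Y)(Vψ)‖ ≤ δ` for every `δ > 0`
  apply eq_of_norm_sub_le_zero
  apply le_of_forall_pos_le_add
  intro δ hδ
  rw [zero_add]
  -- a common interval for both spectra
  set r : ℝ := max ‖A‖ ‖B‖ with hr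
  have hAs : spectrum ℝ A ⊆ Set.Icc (-r) r := fun t ht =>
    ⟨by linarith [(spectrum_real_subset_Icc A ht).1, le_max_left ‖A‖ ‖B‖],
     le_trans (spectrum_real_subset_Icc A ht).2 (le_max_left _ _)⟩
  have hBs : spectrum ℝ B ⊆ Set.Icc (-r) r := fun t ht =>
    ⟨by linarith [(spectrum_real_subset_Icc B ht).1, le_max_right ‖A‖ ‖B‖],
     le_trans (spectrum_real_subset_Icc B ht).2 (le_max_right _ _)⟩
  -- choose `ε` with `(‖V‖ ‖ψ‖ + ‖V ψ‖) ε ≤ δ`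
  set C : ℝ := ‖V‖ * ‖ψ‖ + ‖V ψ‖ + 1 with hC
  have hCpos : 0 < C := by positivity
  set ε : ℝ := δ / C with hεdef
  have hε : 0 < ε := div_pos hδ hCpos
  obtain ⟨p, hp⟩ := exists_polynomial_near_of_continuousOn (-r) r g hg.continuousOn ε hε
  have hpA : ‖cfc g A - aeval A p‖ ≤ ε :=
    norm_cfc_sub_aeval_le hA hg p hε.le fun t ht => (hp t (hAs ht)).le
  have hpB : ‖cfc g B - aeval B p‖ ≤ ε :=
    norm_cfc_sub_aeval_le hB hg p hε.le fun t ht => (hp t (hBs ht)).le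
  -- split the difference through the polynomial
  have hsplit : V (cfc g A ψ) - cfc g B (V ψ) =
      V ((cfc g A - aeval A p) ψ) - (cfc g B - aeval B p) (V ψ) := by
    rw [sub_apply, sub_apply, map_sub, realCLM_apply_aeval_of_intertwine V hV p ψ]
    abel
  rw [hsplit]
  calc ‖V ((cfc g A - aeval A p) ψ) - (cfc g B - aeval B p) (V ψ)‖
      ≤ ‖V ((cfc g A - aeval A p) ψ)‖ + ‖(cfc g B - aeval B p) (V ψ)‖ := norm_sub_le _ _
    _ ≤ ‖V‖ * (‖cfc g A - aeval A p‖ * ‖ψ‖) + ‖cfc g B - aeval B p‖ * ‖V ψ‖ := by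
        gcongr
        · exact (V.le_opNorm _).trans (by gcongr; exact ContinuousLinearMap.le_opNorm _ _)
        · exact ContinuousLinearMap.le_opNorm _ _
    _ ≤ ‖V‖ * (ε * ‖ψ‖) + ε * ‖V ψ‖ := by gcongr
    _ = (‖V‖ * ‖ψ‖ + ‖V ψ‖) * ε := by ring
    _ ≤ C * ε := by gcongr; linarith
    _ = δ := by rw [hεdef]; field_simp

/-- **Real-linear maps commuting with a self-adjoint operator commute with its real functional
calculus** (the case `X = Y`; Rieffel–van Daele 1977, Prop. 2.2 (4): "`P` commutes with `T²`
and hence with `T`"). [cite: RieffelVandaele1977, Prop. 2.2 (4)] -/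
theorem realCLM_apply_cfc_comm (V : H →L[ℝ] H) {A : H →L[ℂ] H} (hA : IsSelfAdjoint A)
    (hV : ∀ ψ, V (A ψ) = A (V ψ)) {g : ℝ → ℝ} (hg : Continuous g) (ψ : H) :
    V (cfc g A ψ) = cfc g A (V ψ) :=
  realCLM_apply_cfc_of_intertwine V hA hA hV hg ψ

/-- Composition form of `realCLM_apply_cfc_of_intertwine`:
`V ∘ g(X) = g(Y) ∘ V` as real-linear maps. [cite: RieffelVandaele1977, Prop. 2.2 and §3 (p. 194)] -/
theorem realCLM_comp_cfc_of_intertwine (V : H →L[ℝ] H) {A B : H →L[ℂ] H}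
    (hA : IsSelfAdjoint A) (hB : IsSelfAdjoint B) (hV : ∀ ψ, V (A ψ) = B (V ψ))
    {g : ℝ → ℝ} (hg : Continuous g) :
    V.comp ((cfc g A).restrictScalars ℝ) = ((cfc g B).restrictScalars ℝ).comp V := by
  ext ψ
  exact realCLM_apply_cfc_of_intertwine V hA hB hV hg ψ

end Literature.Analysis.OperatorTheory
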